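import Literature.Probability.Percolation.KozmaNitzanPreFKG
import HarnessLib

/-!
# `NoHeavyLowerTail` (stmt-CriticalPhenomena-4575), |A| = 5 glued rung — the THREE-PORT observer of `Z(3,2)`,
# part 2: the dictionary of three-point cells

Support file (prover seat `prim-ineq-gen-8`, gen 9; `--supports stmt-CriticalPhenomena-4575`).  No definitions, no named
facts, no sorries.  Memo: `run/shared/lean/prim/prim-ineq-gen-8/FINDING-gen9-THREEPORT.md`.

For a configuration-dependent graph `G ω` on `Fin n` (in part 3: `G ω = openGraph (ω ∩ {e | o ∉ e})`, the open graph off the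
observer `o`) write `R x y` for `(G ω).Reachable x y`.  The THREE-POINT LAW of `(a,b,c)` is the five cells
`U3 = μ{R a b ∧ R a c}`, `Uab = μ{R a b ∧ ¬R a c}`, `Uac = μ{R a c ∧ ¬R a b}`, `Ubc = μ{R b c ∧ ¬R a b}`,
`U0 = μ{¬R a b ∧ ¬R a c ∧ ¬R b c}` — Gladkov's `P(abc), P(ab|c), P(ac|b), P(a|bc), P(a|b|c)` [cite: Gladkov2024, Def. 2.1 (p. 3)].
Every event met in the star expansion of part 1 (`B ~' x` for `B ⊆ {a,b,c}`) is a disjoint union of these cells; this file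
records the dictionary (`real_Rab`, `real_Rba_or_Rca`, `real_notR_notR`, …), using only that `R` is an equivalence relation.
-/

noncomputable section

namespace Summit.CriticalPhenomena.PercolationContinuityZ3.Theorems

open MeasureTheory Set Literature.Probability.LatticeModels Literature.Probability.Percolation
open scoped Classical BigOperators

variable {n : ℕ}

namespace ThreePort

section Dictionary

variable (μ : Measure (BondConfig (Fin n))) [IsFiniteMeasure μ] (G : BondConfig (Fin n) → SimpleGraph (Fin n))
  (a b c : Fin n)

/-- Splitting an event into two disjoint pieces. [folklore] -/
theorem real_eq_add_of_iff {S T U : Set (BondConfig (Fin n))} (h : ∀ ω, ω ∈ S ↔ (ω ∈ T ∨ ω ∈ U))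
    (hd : ∀ ω, ω ∈ T → ω ∉ U) : μ.real S = μ.real T + μ.real U := by
  have hS : S = T ∪ U := by ext ω; rw [mem_union]; exact h ω
  rw [hS, measureReal_union (Set.disjoint_left.2 hd) MeasurableSet.of_discrete]

/-- Splitting an event into three pairwise disjoint pieces. [folklore] -/
theorem real_eq_add_add_of_iff {S T U W : Set (BondConfig (Fin n))}
    (h : ∀ ω, ω ∈ S ↔ (ω ∈ T ∨ ω ∈ U ∨ ω ∈ W)) (hTU : ∀ ω, ω ∈ T → ω ∉ U) (hTW : ∀ ω, ω ∈ T → ω ∉ W)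
    (hUW : ∀ ω, ω ∈ U → ω ∉ W) : μ.real S = μ.real T + μ.real U + μ.real W := by
  rw [real_eq_add_of_iff μ (T := T ∪ U) (U := W) (fun ω => by rw [mem_union, or_assoc]; exact h ω)
    (fun ω hω => hω.elim (hTW ω) (hUW ω)),
    measureReal_union (Set.disjoint_left.2 hTU) MeasurableSet.of_discrete]

/-- `μ{¬R a b ∧ ¬R a c} = Ubc + U0`. [folklore] -/
theorem real_notR_notR :
    μ.real {ω | ¬ (G ω).Reachable a b ∧ ¬ (G ω).Reachable a c} =
      μ.real {ω | (G ω).Reachable b c ∧ ¬ (G ω).Reachable a b} +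
        μ.real {ω | ¬ (G ω).Reachable a b ∧ ¬ (G ω).Reachable a c ∧ ¬ (G ω).Reachable b c} := by
  refine real_eq_add_of_iff μ (fun ω => ?_) (fun ω h1 h2 => h2.2.2 h1.1)
  simp only [mem_setOf_eq]
  constructor
  · rintro ⟨h1, h2⟩
    by_cases h3 : (G ω).Reachable b c
    · exact Or.inl ⟨h3, h1⟩
    · exact Or.inr ⟨h1, h2, h3⟩
  · rintro (⟨h3, h1⟩ | ⟨h1, h2, -⟩)
    · exact ⟨h1, fun h2 => h1 (h2.trans h3.symm)⟩
    · exact ⟨h1, h2⟩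

/-- `μ{¬R b a ∧ ¬R c a} = Ubc + U0`. [folklore] -/
theorem real_notR_notR' :
    μ.real {ω | ¬ (G ω).Reachable b a ∧ ¬ (G ω).Reachable c a} =
      μ.real {ω | (G ω).Reachable b c ∧ ¬ (G ω).Reachable a b} +
        μ.real {ω | ¬ (G ω).Reachable a b ∧ ¬ (G ω).Reachable a c ∧ ¬ (G ω).Reachable b c} := by
  rw [← real_notR_notR μ G a b c]
  congr 1; ext ω; simp only [mem_setOf_eq]
  exact ⟨fun ⟨h1, h2⟩ => ⟨fun h => h1 h.symm, fun h => h2 h.symm⟩, fun ⟨h1, h2⟩ => ⟨fun h => h1 h.symm, fun h => h2 h.symm⟩⟩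

/-- `μ{R a b} = Uab + U3`. [folklore] -/
theorem real_Rab :
    μ.real {ω | (G ω).Reachable a b} =
      μ.real {ω | (G ω).Reachable a b ∧ ¬ (G ω).Reachable a c} +
        μ.real {ω | (G ω).Reachable a b ∧ (G ω).Reachable a c} := by
  refine real_eq_add_of_iff μ (fun ω => ?_) (fun ω h1 h2 => h1.2 h2.2)
  simp only [mem_setOf_eq]
  constructor
  · intro h1
    by_cases h2 : (G ω).Reachable a c
    · exact Or.inr ⟨h1, h2⟩
    · exact Or.inl ⟨h1, h2⟩
  · rintro (⟨h1, -⟩ | ⟨h1, -⟩) <;> exact h1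

/-- `μ{R b a} = Uab + U3`. [folklore] -/
theorem real_Rba :
    μ.real {ω | (G ω).Reachable b a} =
      μ.real {ω | (G ω).Reachable a b ∧ ¬ (G ω).Reachable a c} +
        μ.real {ω | (G ω).Reachable a b ∧ (G ω).Reachable a c} := by
  rw [← real_Rab μ G a b c]
  congr 1; ext ω; simp only [mem_setOf_eq]
  exact ⟨fun h => h.symm, fun h => h.symm⟩

/-- `μ{R a c} = Uac + U3`. [folklore] -/
theorem real_Rac :
    μ.real {ω | (G ω).Reachable a c} =
      μ.real {ω | (G ω).Reachable a c ∧ ¬ (G ω).Reachable a b} +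
        μ.real {ω | (G ω).Reachable a b ∧ (G ω).Reachable a c} := by
  refine real_eq_add_of_iff μ (fun ω => ?_) (fun ω h1 h2 => h1.2 h2.1)
  simp only [mem_setOf_eq]
  constructor
  · intro h1
    by_cases h2 : (G ω).Reachable a b
    · exact Or.inr ⟨h2, h1⟩
    · exact Or.inl ⟨h1, h2⟩
  · rintro (⟨h1, -⟩ | ⟨-, h1⟩) <;> exact h1

/-- `μ{R c a} = Uac + U3`. [folklore] -/
theorem real_Rca :
    μ.real {ω | (G ω).Reachable c a} =
      μ.real {ω | (G ω).Reachable a c ∧ ¬ (G ω).Reachable a b} +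
        μ.real {ω | (G ω).Reachable a b ∧ (G ω).Reachable a c} := by
  rw [← real_Rac μ G a b c]
  congr 1; ext ω; simp only [mem_setOf_eq]
  exact ⟨fun h => h.symm, fun h => h.symm⟩

/-- `μ{R b c} = Ubc + U3`. [folklore] -/
theorem real_Rbc :
    μ.real {ω | (G ω).Reachable b c} =
      μ.real {ω | (G ω).Reachable b c ∧ ¬ (G ω).Reachable a b} +
        μ.real {ω | (G ω).Reachable a b ∧ (G ω).Reachable a c} := by
  refine real_eq_add_of_iff μ (fun ω => ?_) (fun ω h1 h2 => h1.2 h2.1)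
  simp only [mem_setOf_eq]
  constructor
  · intro h1
    by_cases h2 : (G ω).Reachable a b
    · exact Or.inr ⟨h2, h2.trans h1⟩
    · exact Or.inl ⟨h1, h2⟩
  · rintro (⟨h1, -⟩ | ⟨h1, h2⟩)
    · exact h1
    · exact h1.symm.trans h2

/-- `μ{R c b} = Ubc + U3`. [folklore] -/
theorem real_Rcb :
    μ.real {ω | (G ω).Reachable c b} =
      μ.real {ω | (G ω).Reachable b c ∧ ¬ (G ω).Reachable a b} +
        μ.real {ω | (G ω).Reachable a b ∧ (G ω).Reachable a c} := by
  rw [← real_Rbc μ G a b c]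
  congr 1; ext ω; simp only [mem_setOf_eq]
  exact ⟨fun h => h.symm, fun h => h.symm⟩

/-- `μ{R b a ∨ R c a} = Uab + Uac + U3`. [folklore] -/
theorem real_Rba_or_Rca :
    μ.real {ω | (G ω).Reachable b a ∨ (G ω).Reachable c a} =
      μ.real {ω | (G ω).Reachable a b ∧ ¬ (G ω).Reachable a c} +
        μ.real {ω | (G ω).Reachable a c ∧ ¬ (G ω).Reachable a b} +
          μ.real {ω | (G ω).Reachable a b ∧ (G ω).Reachable a c} := by
  refine real_eq_add_add_of_iff μ (fun ω => ?_) (fun ω h1 h2 => h1.2 h2.1) (fun ω h1 h2 => h1.2 h2.2)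
    (fun ω h1 h2 => h1.2 h2.1)
  simp only [mem_setOf_eq]
  constructor
  · rintro (h | h)
    · by_cases h2 : (G ω).Reachable a c
      · exact Or.inr (Or.inr ⟨h.symm, h2⟩)
      · exact Or.inl ⟨h.symm, h2⟩
    · by_cases h2 : (G ω).Reachable a b
      · exact Or.inr (Or.inr ⟨h2, h.symm⟩)
      · exact Or.inr (Or.inl ⟨h.symm, h2⟩)
  · rintro (⟨h1, -⟩ | ⟨h1, -⟩ | ⟨h1, -⟩)
    · exact Or.inl h1.symm
    · exact Or.inr h1.symm
    · exact Or.inl h1.symm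

/-- `μ{R a b ∨ R c b} = Uab + Ubc + U3`. [folklore] -/
theorem real_Rab_or_Rcb :
    μ.real {ω | (G ω).Reachable a b ∨ (G ω).Reachable c b} =
      μ.real {ω | (G ω).Reachable a b ∧ ¬ (G ω).Reachable a c} +
        μ.real {ω | (G ω).Reachable b c ∧ ¬ (G ω).Reachable a b} +
          μ.real {ω | (G ω).Reachable a b ∧ (G ω).Reachable a c} := by
  refine real_eq_add_add_of_iff μ (fun ω => ?_) (fun ω h1 h2 => h2.2 h1.1) (fun ω h1 h2 => h1.2 h2.2)
    (fun ω h1 h2 => h1.2 h2.1)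
  simp only [mem_setOf_eq]
  constructor
  · rintro (h | h)
    · by_cases h2 : (G ω).Reachable a c
      · exact Or.inr (Or.inr ⟨h, h2⟩)
      · exact Or.inl ⟨h, h2⟩
    · by_cases h2 : (G ω).Reachable a b
      · exact Or.inr (Or.inr ⟨h2, h2.trans h.symm⟩)
      · exact Or.inr (Or.inl ⟨h.symm, h2⟩)
  · rintro (⟨h1, -⟩ | ⟨h1, -⟩ | ⟨h1, h2⟩)
    · exact Or.inl h1
    · exact Or.inr h1.symm
    · exact Or.inl h1

/-- `μ{R a c ∨ R b c} = Uac + Ubc + U3`. [folklore] -/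
theorem real_Rac_or_Rbc :
    μ.real {ω | (G ω).Reachable a c ∨ (G ω).Reachable b c} =
      μ.real {ω | (G ω).Reachable a c ∧ ¬ (G ω).Reachable a b} +
        μ.real {ω | (G ω).Reachable b c ∧ ¬ (G ω).Reachable a b} +
          μ.real {ω | (G ω).Reachable a b ∧ (G ω).Reachable a c} := by
  refine real_eq_add_add_of_iff μ (fun ω => ?_) (fun ω h1 h2 => h1.2 (h1.1.trans h2.1.symm))
    (fun ω h1 h2 => h1.2 h2.1) (fun ω h1 h2 => h1.2 h2.1)
  simp only [mem_setOf_eq]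
  constructor
  · rintro (h | h)
    · by_cases h2 : (G ω).Reachable a b
      · exact Or.inr (Or.inr ⟨h2, h⟩)
      · exact Or.inl ⟨h, h2⟩
    · by_cases h2 : (G ω).Reachable a b
      · exact Or.inr (Or.inr ⟨h2, h2.trans h⟩)
      · exact Or.inr (Or.inl ⟨h, h2⟩)
  · rintro (⟨h1, -⟩ | ⟨h1, -⟩ | ⟨-, h2⟩)
    · exact Or.inl h1
    · exact Or.inr h1
    · exact Or.inl h2


omit [IsFiniteMeasure μ] in
/-- `μ{¬R b a ∧ R b c} = Ubc`. [folklore] -/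
theorem real_notRba_Rbc :
    μ.real {ω | ¬ (G ω).Reachable b a ∧ (G ω).Reachable b c} =
      μ.real {ω | (G ω).Reachable b c ∧ ¬ (G ω).Reachable a b} := by
  congr 1; ext ω; simp only [mem_setOf_eq]
  exact ⟨fun ⟨h1, h2⟩ => ⟨h2, fun h => h1 h.symm⟩, fun ⟨h1, h2⟩ => ⟨fun h => h2 h.symm, h1⟩⟩

omit [IsFiniteMeasure μ] in
/-- `μ{¬R c a ∧ R c b} = Ubc`. [folklore] -/
theorem real_notRca_Rcb :
    μ.real {ω | ¬ (G ω).Reachable c a ∧ (G ω).Reachable c b} =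
      μ.real {ω | (G ω).Reachable b c ∧ ¬ (G ω).Reachable a b} := by
  congr 1; ext ω; simp only [mem_setOf_eq]
  constructor
  · rintro ⟨h1, h2⟩
    exact ⟨h2.symm, fun h => h1 (h2.trans h.symm)⟩
  · rintro ⟨h1, h2⟩
    exact ⟨fun h => h2 ((h1.trans h).symm), h1.symm⟩

end Dictionary

end ThreePort

end Summit.CriticalPhenomena.PercolationContinuityZ3.Theorems

end
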